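import Literature.AlgebraicGeometry.GroupSchemes.BTGroupConnectedDimOneCoordinates   -- ★ p845010 (S): natural coordinates `x n`, `θ n`, `c n R f = ptEquiv f (x n)`
import Literature.AlgebraicGeometry.GroupSchemes.BTGroupOModuleLawOfCoordinates      -- ★ (P4b): tangent character + formal `𝒪`-module law in the coordinates
import Literature.AlgebraicGeometry.GroupSchemes.BTGroupDictionaryOfCoordinates      -- ★ p845025 (P5): `coord_one_eq_zero_of_law`
import Literature.AlgebraicGeometry.GroupSchemes.BTGroupFrobeniusKernelInCoordinates -- ★ (FKw): `finrank_quotient_span_symm_pow`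
import Literature.AlgebraicGeometry.GroupSchemes.HopfIdealOfClosedSubgroup           -- ★ `ptEquiv_isoSpecOver_inv_comp_apply`, `exists_comp_eq_iff_ker_appTop_le`, `exists_algEquiv_quotient_ker_appTop`
import Literature.RingTheory.FormalGroups.FormalGroupHomFrobenius                   -- ★ p844727: `FormalGroupHom.exists_eq_expand_pow_coeff_one_ne_zero`
import Literature.RingTheory.FormalGroups.FormalOModuleHeightOfFrobeniusForm        -- ★ p844746: `exists_isOfHeight_of_act_eq_subst_X_pow_prime_pow`, `exists_prime_charP_of_algebraMap_uniformizer_eq_zero`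
import Literature.RingTheory.FormalGroups.FormalOModuleKernelPoints                 -- ★ HL-C: `FormalOModuleLaw.kernelPointsOfHeight`
import HarnessLib

/-!
# The `[ϖ]`-kernel of a connected one-dimensional Barsotti–Tate `𝒪`-module over a field is `Spec k[X]⧸(X^{q^h})`, `h ≥ 1` the `𝒪`-height

Topic `Literature/AlgebraicGeometry/GroupSchemes`; namespace `Literature.AlgebraicGeometry.GroupSchemes.UniformizerKernel`.  THEOREMS ONLY
(no definition, no instance, no notation, no named fact, no `sorry`).  Cell `hodgecm-mathlib` (D-0151), programme P6 «MOD» (crux hLiu418 =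
stmt-HodgeConjecture-24832, `--supports`, count-neutral): organ **(N2) «EXPONENT OF THE `ϖ`-KERNEL» = THE HEART of the P6b sub-line
«ONE-DIMENSIONAL BLOCK NUMERICS»** (`Cruxes/HLiu418/Lines/F0_P6b_BlockNumerics.lean`, desk F0P6b-plan (g2), cand v1 49deda72 :137–:153): it PAYS
the registered stub `stub_N2_exponentOfKernel` BY NAME (same explicit binders in the same order).  HC_CM is proved only modulo the printed
citations until rung 0 closes; this file is generic and changes no count.

THE PRINT ([HarrisTaylorAMS2001] §II.1 p. 59, §II.2; [Tate1967] §2.2; [Frohlich1968] Ch. I §3).  `C` a CONNECTED ONE-DIMENSIONAL BT group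
of height `H₀ ≥ 1` over a field `k` of characteristic `p` (`Γ(C[pⁿ]) ≃ k[X]⧸(X^{p^{nH₀}})`) with a ring action `β` of a DVR `𝒪` (uniformiser
`ϖ`, `#(𝒪⧸ϖ) = q = p^f`, `ϖ ∣ p ∣ ϖ^e`).  [Tate1967] §2.2: `C = M[p^∞]` for a formal `𝒪`-module law `M` over `k` in a coordinate `X` with
`Γ(C[p]) = k[X]⧸(X^{p^{H₀}})` (★ natural coordinates + ★ law); [Frohlich1968] I §3 Thm. 2: `[ϖ]_M = 0` or `[ϖ]_M(X) = u(X^{q^h})`, `u′(0) ≠ 0`,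
for an `𝒪`-HEIGHT `h ≥ 1`; then a point with coordinate `x` is killed by `β(ϖ)` iff `x^{q^h} = 0` (★ HL-C), so `U = Ker β(ϖ)|_{C[p]} = V(X^{q^h})`
and **`Γ(U) ≃ k[X]⧸(X^{q^h})`** — given `q^h ≤ p^{H₀}` and `[ϖ]_M ≠ 0`, both of which hold because `ϖ ∣ p`: a point of `C[p²]` killed by `β(ϖ)`
is killed by `[p]`, so lies in `C[p]`, while the point of `C[p²]` over `k[X]⧸(X^{p^{2H₀}})` with coordinate `X̄^{p^{H₀−1}}` would be killed but
is not in `C[p]`.  ORD `h = 1`: `U ≃ Spec k[X]⧸(X^q)`; SS `h = 2`: `U ≃ Spec k[X]⧸(X^{q²})`.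

## Contents
* §1 `exists_coordinates_law_of_isConnectedDimOne` — the P6d dictionary RE-ASSEMBLED WITH THE GENERATOR EXPOSED (`x n`, `θ n X̄ = x n`,
  `c f = (alg. map of f)(x n)`, `c 1 = 0`, `χ`, `M` with `c (f·g) = M(c f, c g)`, `c (f ≫ β a) = [a]_M (c f)`; ★ (S) + ★ (P4b));
* §2 `map_uniformizer_eq_zero`, `act_eq_zero_or_exists_isOfHeight` — the height dichotomy at `ϖ` (★ Fröhlich organs);
* §3 THE LAYER-2 TEST `coord_pow_eq_zero_of_comp_app_eq_one`, `false_of_forall_pow_eq_zero_comp_app_eq_one` (`[ϖ]_M ≠ 0` and `f·h ≤ H`);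
* §4 THE IDEAL `ker_appTop_eq_span_pow` (`ker Γ(u) = (x₁^{q^h})`, two points criteria, ★ `HopfIdealOfClosedSubgroup`);
* §5 THE ALGEBRA `nonempty_algEquiv_quotient_span_pow` (`Γ⧸(x₁^M) ≃ₐ k[X]⧸(X^M)`, `M ≤ p^H`) and the head
  **`exists_algEquiv_quotient_X_pow_of_uniformizerKernel`** = `stub_N2_exponentOfKernel`.

## References
* [HarrisTaylorAMS2001] M. Harris, R. Taylor, *The geometry and cohomology of some simple Shimura varieties* (2001) — §II.1 p. 59, §II.2.
* [Tate1967] J. Tate, *p-divisible groups*, Proc. Conf. Local Fields (Driebergen, 1966), Springer 1967 — §2.2 (Prop. 1 and its proof).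
* [Frohlich1968] A. Fröhlich, *Formal Groups*, LNM 74 (1968) — Ch. I §3 (Thm. 2).
* [Hazewinkel1978] M. Hazewinkel, *Formal Groups and Applications* (1978) — (18.3.4), (21.8.12).
-/

set_option autoImplicit false

-- Mathlib's `Over`/`Scheme` APIs and the layers' group structures (`letI := C.grpObj n`) are stated across semireducible wrappers
-- (as in ★ `GroupSchemes/*`).
set_option backward.isDefEq.respectTransparency false

noncomputable section

open CategoryTheory CategoryTheory.Limits AlgebraicGeometry MonoidalCategory CartesianMonoidalCategory Polynomial

open scoped MonObj

universe u v

namespace Literature.AlgebraicGeometry.GroupSchemes.UniformizerKernel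

open Literature.AlgebraicGeometry.Motives (SchemeOver)
open Literature.AlgebraicGeometry.Motives.AlgPoints (specOverMapOfAlgHom specOverMapOfAlgHom_left)
open Literature.AlgebraicGeometry.GroupSchemes Literature.AlgebraicGeometry.GroupSchemes.AffineGroupScheme
open Literature.RingTheory.FormalGroups (FormalGroupHom FormalOModuleLaw evalNilp evalNilp₂)

/-! ## §1 The dictionary with the generator exposed -/

section Dictionary

variable {k : Type u} [Field k] {p H : ℕ} (B : BTGroup (Spec (.of k)) p H)

/-- **COORDINATES, LAW AND ACTION OF A CONNECTED ONE-DIMENSIONAL BT GROUP WITH `𝒪`-ACTION — with the generators exposed.**  For `B`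
connected of dimension one (`IsConnectedDimOne B`), `p ≥ 2`, `H ≥ 1`, and a ring action `β` of `𝒪`: generators `x n` of the maximal ideals of
the layer algebras, coordinates `θ n : k[X]⧸(X^{p^{nH}}) ≃ₐ[k] Γ(B.G n)` with `θ n X̄ = x n`, natural bijections `c n R : B.G n (R) ≃ {r ∣ r^{p^{nH}} = 0}`
with `c f = (alg. map of f)(x n)` compatible with `incl`, `c 1 = 0`, the tangent character `χ : 𝒪 → k` and a formal `𝒪`-module law `M` over `k`
with `c (f·g) = M(c f, c g)` and `c (f ≫ β a) = [a]_M (c f)` (★ `exists_naturalCoordinates_of_isConnectedDimOne` + ★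
`exists_formalOModuleLaw_of_coordinates`; the P6d letter HL-D keeps only `∃ e`). [cite: Tate1967, §2.2 (Prop. 1 and its proof)] -/
theorem exists_coordinates_law_of_isConnectedDimOne (hp : 2 ≤ p) (hH : 0 < H) (hB : IsConnectedDimOne B)
    {𝒪 : Type v} [CommRing 𝒪] (β : 𝒪 → BTGroup.Hom B B) (hβ : IsRingActionBT B β) :
    ∃ (x : ∀ n, Alg (B.G n))
      (θ : ∀ n, (k[X] ⧸ Ideal.span {(X : k[X]) ^ (p ^ (n * H))}) ≃ₐ[k] Alg (B.G n))
      (c : ∀ (n : ℕ) (R : Type u) [CommRing R] [Algebra k R], (specOver (A := k) R ⟶ B.G n) ≃ {x : R // x ^ (p ^ (n * H)) = 0})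
      (χ : 𝒪 →+* k),
      letI := χ.toAlgebra
      ∃ M : FormalOModuleLaw 𝒪 k,
        (∀ n, θ n (Ideal.Quotient.mk _ X) = x n) ∧
        (∀ (n : ℕ) (R : Type u) [CommRing R] [Algebra k R] (f : specOver (A := k) R ⟶ B.G n),
          haveI := B.isAffine_left n; ((c n R) f).1 = ptEquiv (B.G n) R f (x n)) ∧
        (∀ (n : ℕ) (R : Type u) [CommRing R] [Algebra k R] (f : specOver (A := k) R ⟶ B.G n),
          ((c (n + 1) R) (f ≫ B.incl n)).1 = ((c n R) f).1) ∧
        (∀ (n : ℕ) (R : Type u) [CommRing R] [Algebra k R], letI := B.grpObj n; ((c n R) 1).1 = 0) ∧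
        (∀ (a : 𝒪) (n : ℕ) (R : Type u) [CommRing R] [Algebra k R] (f : specOver (A := k) R ⟶ B.G n),
          ((c n R) (f ≫ (β a).app n)).1 = evalNilp (M.act a).toPowerSeries ((c n R) f).1) := by
  haveI hAff : ∀ n, IsAffine (B.G n).left := B.isAffine_left
  obtain ⟨x, θ, c, hπx, hθ, hc⟩ := B.exists_naturalCoordinates_of_isConnectedDimOne hB
  -- naturality and compatibility with the transitions, read off `c f = (alg. map of f)(x n)`
  have hnat : ∀ (n : ℕ) (R R' : Type u) [CommRing R] [Algebra k R] [CommRing R'] [Algebra k R'] (φ : R →ₐ[k] R')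
      (g : specOver (A := k) R' ⟶ specOver (A := k) R), g.left = Spec.map (CommRingCat.ofHom φ.toRingHom) →
      ∀ f : specOver (A := k) R ⟶ B.G n, ((c n R') (g ≫ f)).1 = φ ((c n R) f).1 := by
    intro n R R' _ _ _ _ φ g hg f
    have hg' : g = specOverMapOfAlgHom φ := Over.OverMorphism.ext (by rw [hg, specOverMapOfAlgHom_left])
    rw [hc, hc, hg', AffineGroupScheme.ptEquiv_comap, AlgHom.comp_apply]
  have hincl : ∀ (n : ℕ) (R : Type u) [CommRing R] [Algebra k R] (f : specOver (A := k) R ⟶ B.G n),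
      ((c (n + 1) R) (f ≫ B.incl n)).1 = ((c n R) f).1 := by
    intro n R _ _ f
    rw [hc, hc, ptEquiv_comp_apply, hπx]
  obtain ⟨χ, M, hlaw, hact⟩ := B.exists_formalOModuleLaw_of_coordinates c hp hH hnat hincl β hβ
  letI := χ.toAlgebra
  haveI := M.isComm'
  refine ⟨x, θ, c, χ, M, hθ, hc, hincl, fun n R _ _ => ?_, hact⟩
  exact coord_one_eq_zero_of_law B c M.toFormalGroup hlaw n R

end Dictionary

/-! ## §2 The height dichotomy for the law at the uniformiser -/

section Height

variable {𝒪 : Type v} [CommRing 𝒪] [IsDomain 𝒪] [IsDiscreteValuationRing 𝒪] [Finite (IsLocalRing.ResidueField 𝒪)]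
variable {k : Type u} [Field k]

omit [IsDomain 𝒪] [IsDiscreteValuationRing 𝒪] [Finite (IsLocalRing.ResidueField 𝒪)] in
/-- The tangent character kills the uniformiser in MIXED CHARACTERISTIC: if `p ∣ ϖ^e` in `𝒪` and `p = 0` in `k`, then `χ(ϖ)^e = χ(p)·χ(c) = 0`,
so `χ(ϖ) = 0` in the field `k`. [cite: Tate1967, §2.2] -/
theorem map_uniformizer_eq_zero (p : ℕ) (hp : (p : k) = 0) (χ : 𝒪 →+* k) (ϖ : 𝒪) (hpe : ∃ e : ℕ, (p : 𝒪) ∣ ϖ ^ e) : χ ϖ = 0 := by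
  obtain ⟨e, c, hc⟩ := hpe
  have h0 : χ ϖ ^ e = 0 := by rw [← map_pow, hc, map_mul, map_natCast, hp, zero_mul]
  exact pow_eq_zero_iff'.mp h0 |>.1

/-- **HEIGHT DICHOTOMY at the uniformiser** ([Frohlich1968] I §3 Thm. 2, as assembled in ★ `Theorems/F0P6dStubHLA`): for a formal `𝒪`-module
law `M` over a field `k` in which `ϖ ↦ 0`, either `[ϖ]_M = 0` or `[ϖ]_M(X) = u(X^{q^h})` with `u′(0) ≠ 0` for an `𝒪`-height `h ≥ 1`
(`q = #(𝒪⧸ϖ)`).  ★ `exists_prime_charP_of_algebraMap_uniformizer_eq_zero` + ★ `exists_eq_expand_pow_coeff_one_ne_zero` + ★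
`exists_isOfHeight_of_act_eq_subst_X_pow_prime_pow`. [cite: Frohlich1968, Ch. I §3 (Thm. 2)] [cite: HarrisTaylorAMS2001, §II.1 p. 59] -/
theorem act_eq_zero_or_exists_isOfHeight [Algebra 𝒪 k] (ϖ : 𝒪) (hϖ : Irreducible ϖ) (hϖk : algebraMap 𝒪 k ϖ = 0)
    (M : FormalOModuleLaw 𝒪 k) :
    (M.act ϖ).toPowerSeries = 0 ∨ ∃ h, 0 < h ∧ M.IsOfHeight ϖ (Nat.card (IsLocalRing.ResidueField 𝒪)) h := by
  by_cases h0 : (M.act ϖ).toPowerSeries = 0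
  · exact Or.inl h0
  · right
    obtain ⟨p, hp, hchar⟩ := Literature.RingTheory.FormalGroups.exists_prime_charP_of_algebraMap_uniformizer_eq_zero hϖ hϖk
    haveI : Fact p.Prime := ⟨hp⟩
    obtain ⟨n, g, hg, h1⟩ := (M.act ϖ).exists_eq_expand_pow_coeff_one_ne_zero p h0
    have hr : (M.act ϖ).toPowerSeries = PowerSeries.subst ((PowerSeries.X : PowerSeries k) ^ (p ^ n)) g.toPowerSeries := by
      rw [hg, PowerSeries.expand_apply]
    exact M.exists_isOfHeight_of_act_eq_subst_X_pow_prime_pow ϖ hϖ hϖk p g.constantCoeff_eq_zero h1 hr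

end Height

/-! ## §3 The layer-2 test: a point of `C.G 2` killed by `β ϖ` lies in `C.G 1` -/

section LayerTwo

variable {k : Type u} [Field k] {p H : ℕ} (B : BTGroup (Spec (.of k)) p H)
  (c : ∀ (n : ℕ) (R : Type u) [CommRing R] [Algebra k R], (specOver (A := k) R ⟶ B.G n) ≃ {x : R // x ^ (p ^ (n * H)) = 0})
  {𝒪 : Type v} [CommRing 𝒪] {β : 𝒪 → BTGroup.Hom B B}

/-- **A POINT OF `C.G 2` KILLED BY `β(ϖ)` IS KILLED BY `[p]`, HENCE LIES IN `C.G 1 = Ker [p]`, HENCE ITS COORDINATE SATISFIES `x^{p^H} = 0`**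
(`ϖ ∣ p`: `β(p) = β(ϖ) ≫ β(p∕ϖ)` by ★ `IsRingActionBT.map_mul`, `β(p) = [p] = 𝟙^p` by ★ `IsRingActionBT.app_natCast`; `isPullback_incl 1`
lifts through `incl 1`; the coordinates are compatible with `incl`). [cite: Tate1967, §2 (2.1) and §2.2] -/
theorem coord_pow_eq_zero_of_comp_app_eq_one (hβ : IsRingActionBT B β) {ϖ : 𝒪} (hϖp : ϖ ∣ (p : 𝒪))
    (hincl : ∀ (n : ℕ) (R : Type u) [CommRing R] [Algebra k R] (f : specOver (A := k) R ⟶ B.G n),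
      ((c (n + 1) R) (f ≫ B.incl n)).1 = ((c n R) f).1)
    {R : Type u} [CommRing R] [Algebra k R] (f : specOver (A := k) R ⟶ B.G 2)
    (hf : letI := B.grpObj 2; f ≫ (β ϖ).app 2 = 1) :
    ((c 2 R) f).1 ^ (p ^ H) = 0 := by
  letI := B.grpObj 2
  letI := B.grpObj 1
  obtain ⟨c', hc'⟩ := hϖp
  -- killed by `[p] = β p = β ϖ ≫ β c'`
  have hp1 : f ≫ (𝟙 (B.G 2)) ^ (p ^ 1) = 1 := by
    rw [pow_one, ← hβ.app_natCast p 2, hc', mul_comm, hβ.map_mul, BTGroup.Hom.comp_app, ← Category.assoc, hf]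
    haveI := (β c').isMonHom_app 2
    exact MonObj.one_comp _
  -- hence lifts through `incl 1 : C.G 1 = Ker [p] ↪ C.G 2`
  have hw : f ≫ (𝟙 (B.G 2)) ^ (p ^ 1) = toUnit _ ≫ η[B.G 2] := by rw [hp1]; rfl
  obtain ⟨g, hg⟩ : ∃ g : specOver (A := k) R ⟶ B.G 1, g ≫ B.incl 1 = f :=
    ⟨(B.isPullback_incl 1).lift f (toUnit _) hw, (B.isPullback_incl 1).lift_fst f (toUnit _) hw⟩
  -- so its coordinate is a layer-1 coordinate
  have h1 := hincl 1 R g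
  rw [hg] at h1
  have e : ∀ y : R, y ^ (p ^ (1 * H)) = y ^ (p ^ H) := fun y => by rw [one_mul]
  rw [h1, ← e]
  exact ((c 1 R) g).2

/-- **THE TEST POINT.**  If every point of `C.G 2` (over every `k`-algebra) whose coordinate `y` satisfies `y^N = 0` is killed by `β(ϖ)`, for
some `N ≥ p^{H+1}`, we reach a contradiction: over `R := k[X]⧸(X^{p^{2H}})` the point with coordinate `y := X̄^{p^{H−1}}` has `y^N = 0`, so it
is killed, so `y^{p^H} = X̄^{p^{2H−1}} = 0` (`coord_pow_eq_zero_of_comp_app_eq_one`) — false.  Used twice: `[ϖ]_M = 0` is impossible, and the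
`𝒪`-height satisfies `f·h ≤ H`. [cite: Tate1967, §2.2] [cite: HarrisTaylorAMS2001, §II.1 p. 59] -/
theorem false_of_forall_pow_eq_zero_comp_app_eq_one (hp : 2 ≤ p) (hH : 0 < H) (hβ : IsRingActionBT B β) {ϖ : 𝒪}
    (hϖp : ϖ ∣ (p : 𝒪))
    (hincl : ∀ (n : ℕ) (R : Type u) [CommRing R] [Algebra k R] (f : specOver (A := k) R ⟶ B.G n),
      ((c (n + 1) R) (f ≫ B.incl n)).1 = ((c n R) f).1)
    {N : ℕ} (hN : p ^ (H + 1) ≤ N)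
    (hK : ∀ (R : Type u) [CommRing R] [Algebra k R] (t : specOver (A := k) R ⟶ B.G 2),
      ((c 2 R) t).1 ^ N = 0 → letI := B.grpObj 2; t ≫ (β ϖ).app 2 = 1) : False := by
  letI := B.grpObj 2
  have hp1 : 1 < p := hp
  have hp0 : 0 < p := by omega
  -- the test ring and coordinate
  let R : Type u := k[X] ⧸ Ideal.span {(X : k[X]) ^ (p ^ (2 * H))}
  let y : R := Ideal.Quotient.mk _ X ^ (p ^ (H - 1))
  have hpow : ∀ m : ℕ, p ^ (2 * H) ≤ m → (Ideal.Quotient.mk (Ideal.span {(X : k[X]) ^ (p ^ (2 * H))}) X) ^ m = 0 := by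
    intro m hm
    rw [← map_pow, Ideal.Quotient.eq_zero_iff_mem, Ideal.mem_span_singleton]
    exact pow_dvd_pow X hm
  have h2H : p ^ (H - 1) * p ^ (H + 1) = p ^ (2 * H) := by
    rw [← pow_add]; congr 1; omega
  have hy2 : y ^ (p ^ (2 * H)) = 0 := by
    change (Ideal.Quotient.mk _ X ^ (p ^ (H - 1))) ^ (p ^ (2 * H)) = 0
    rw [← pow_mul]
    exact hpow _ (Nat.le_mul_of_pos_left _ (pow_pos hp0 _))
  have hyN : y ^ N = 0 := by
    change (Ideal.Quotient.mk _ X ^ (p ^ (H - 1))) ^ N = 0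
    rw [← pow_mul]
    refine hpow _ ?_
    calc p ^ (2 * H) = p ^ (H - 1) * p ^ (H + 1) := h2H.symm
      _ ≤ p ^ (H - 1) * N := Nat.mul_le_mul_left _ hN
  -- the point with coordinate `y` is killed, hence `y^{p^H} = 0`
  let t : specOver (A := k) R ⟶ B.G 2 := (c 2 R).symm ⟨y, hy2⟩
  have hty : ((c 2 R) t).1 = y := by rw [Equiv.apply_symm_apply]
  have hkill : t ≫ (β ϖ).app 2 = 1 := hK R t (by rw [hty]; exact hyN)
  have hyH : y ^ (p ^ H) = 0 := by rw [← hty]; exact coord_pow_eq_zero_of_comp_app_eq_one B c hβ hϖp hincl t hkill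
  -- but `y^{p^H} = X̄^{p^{2H−1}} ≠ 0`
  have hexp : p ^ (H - 1) * p ^ H = p ^ (2 * H - 1) := by
    rw [← pow_add]; congr 1; omega
  have hmem : (X : k[X]) ^ (p ^ (2 * H - 1)) ∈ Ideal.span {(X : k[X]) ^ (p ^ (2 * H))} := by
    rw [← Ideal.Quotient.eq_zero_iff_mem, map_pow, ← hexp]
    have hy' : (Ideal.Quotient.mk (Ideal.span {(X : k[X]) ^ (p ^ (2 * H))}) X) ^ (p ^ (H - 1) * p ^ H) = y ^ (p ^ H) :=
      pow_mul _ _ _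
    rw [hy']
    exact hyH
  rw [Ideal.mem_span_singleton, pow_dvd_pow_iff X_ne_zero Polynomial.not_isUnit_X] at hmem
  have hlt : 2 * H - 1 < 2 * H := by omega
  exact absurd hmem (not_le.mpr (Nat.pow_lt_pow_right hp1 hlt))

end LayerTwo

/-! ## §4 The ideal of the `[ϖ]`-kernel -/

section KernelIdeal

variable {k : Type u} [Field k] {p H : ℕ} (B : BTGroup (Spec (.of k)) p H) (x : ∀ n, Alg (B.G n))
  (c : ∀ (n : ℕ) (R : Type u) [CommRing R] [Algebra k R], (specOver (A := k) R ⟶ B.G n) ≃ {x : R // x ^ (p ^ (n * H)) = 0})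
  {𝒪 : Type v} [CommRing 𝒪] [Algebra 𝒪 k] {β : 𝒪 → BTGroup.Hom B B} {M : FormalOModuleLaw 𝒪 k}

/-- **THE IDEAL OF THE `[ϖ]`-KERNEL IS `(x₁^N)`.**  If the coordinate of a point `t` of `B.G 1` is `(alg. map of t)(x₁)`, `c 1 = 0`,
`c (t ≫ β a) = [a]_M (c t)`, and `[ϖ]_M` kills a nilpotent `y` iff `y^N = 0` (★ HL-C), then for a closed subscheme `u : U ↪ B.G 1` through which
EXACTLY the points killed by `β(ϖ)` factor, `ker Γ(u) = (x₁^N)`: a point `t` is killed by `β(ϖ)` iff `((alg. map of t)(x₁))^N = 0`; test on the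
quotient point `Spec Γ(B.G 1)⧸(x₁^N) ↪ B.G 1` (⊆, ★ `exists_comp_eq_iff_ker_appTop_le`) and on the tautological point of `U` (⊇, ★
`ptEquiv_isoSpecOver_inv_comp_apply`). [cite: HarrisTaylorAMS2001, §II.1 p. 59] [cite: Tate1967, §2.2] -/
theorem ker_appTop_eq_span_pow
    (hc : ∀ (n : ℕ) (R : Type u) [CommRing R] [Algebra k R] (f : specOver (A := k) R ⟶ B.G n),
      haveI := B.isAffine_left n; ((c n R) f).1 = ptEquiv (B.G n) R f (x n))
    (hone : ∀ (n : ℕ) (R : Type u) [CommRing R] [Algebra k R], letI := B.grpObj n; ((c n R) 1).1 = 0)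
    (hact : ∀ (a : 𝒪) (n : ℕ) (R : Type u) [CommRing R] [Algebra k R] (f : specOver (A := k) R ⟶ B.G n),
      ((c n R) (f ≫ (β a).app n)).1 = evalNilp (M.act a).toPowerSeries ((c n R) f).1)
    {ϖ : 𝒪} {N : ℕ}
    (hkill : ∀ (R : Type u) [CommRing R] [Algebra k R] (y : R), IsNilpotent y → (evalNilp (M.act ϖ).toPowerSeries y = 0 ↔ y ^ N = 0))
    (hx : IsNilpotent (x 1)) (U : SchemeOver k) (u : U ⟶ B.G 1) (hu : IsClosedImmersion u.left)
    (hkerU : letI := B.grpObj 1; ∀ ⦃T : SchemeOver k⦄ (t : T ⟶ B.G 1), t ≫ (β ϖ).app 1 = 1 ↔ ∃ s : T ⟶ U, s ≫ u = t) :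
    haveI := B.isAffine_left 1
    (RingHom.ker u.left.appTop.hom : Ideal (Alg (B.G 1))) = Ideal.span {x 1 ^ N} := by
  haveI hA : IsAffine (B.G 1).left := B.isAffine_left 1
  letI := B.grpObj 1
  haveI : IsClosedImmersion u.left := hu
  haveI : IsAffine U.left := isAffine_left_of_isClosedImmersion u
  -- a point `t` is killed by `β ϖ` iff `((alg. map of t)(x 1))^N = 0`
  have key : ∀ (R : Type u) [CommRing R] [Algebra k R] (t : specOver (A := k) R ⟶ B.G 1),
      t ≫ (β ϖ).app 1 = 1 ↔ (ptEquiv (B.G 1) R t (x 1)) ^ N = 0 := by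
    intro R _ _ t
    have hnil : IsNilpotent (ptEquiv (B.G 1) R t (x 1)) := hx.map _
    rw [← hkill R _ hnil, ← hc 1 R t, ← hact ϖ 1 R t]
    constructor
    · intro h
      rw [h, hone]
    · intro h
      apply (c 1 R).injective
      exact Subtype.ext (h.trans (hone 1 R).symm)
  apply le_antisymm
  · -- `⊆`: the quotient point by `(x 1 ^ N)` is killed, hence factors through `u`
    haveI : IsAffine (Motives.specOver k (Alg (B.G 1) ⧸ Ideal.span {x 1 ^ N})).left :=
      inferInstanceAs (IsAffine (Spec (CommRingCat.of (Alg (B.G 1) ⧸ Ideal.span {x 1 ^ N}))))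
    have hq : quotIncl (B.G 1) (Ideal.span {x 1 ^ N}) ≫ (β ϖ).app 1 = 1 := by
      rw [key, ptEquiv_quotIncl, Ideal.Quotient.mkₐ_eq_mk, ← map_pow, Ideal.Quotient.eq_zero_iff_mem]
      exact Ideal.mem_span_singleton_self _
    have hle := (exists_comp_eq_iff_ker_appTop_le u (quotIncl (B.G 1) (Ideal.span {x 1 ^ N}))).mp ((hkerU _).mp hq)
    intro a ha
    have h := hle ha
    rw [RingHom.mem_ker, AlgHom.toRingHom_eq_coe, AlgHom.coe_toRingHom, ptEquiv_quotIncl, Ideal.Quotient.mkₐ_eq_mk,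
      Ideal.Quotient.eq_zero_iff_mem] at h
    exact h
  · -- `⊇`: the tautological point of `U` factors through `u`, hence is killed
    rw [Ideal.span_le, Set.singleton_subset_iff, SetLike.mem_coe, RingHom.mem_ker, map_pow]
    have ht : ((isoSpecOver U).inv ≫ u) ≫ (β ϖ).app 1 = 1 := (hkerU _).mpr ⟨(isoSpecOver U).inv, rfl⟩
    have h := (key _ _).mp ht
    rwa [ptEquiv_isoSpecOver_inv_comp_apply] at h

end KernelIdeal

/-! ## §5 The algebra `Γ⧸(x₁^M) ≃ k[X]⧸(X^M)` and the head -/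

section Algebra

variable {k : Type u} [Field k]

/-- **`A⧸(x^M) ≃ₐ[k] k[X]⧸(X^M)` for `θ : k[X]⧸(X^N) ≃ₐ[k] A`, `x = θ X̄`, `M ≤ N`**: the map `X ↦ x̄` is onto (`A = k[x]`) between `k`-spaces of
the same dimension `M` (★ `finrank_quotient_span_symm_pow`, ★ `finrank_eq_of_algEquiv_quotient_X_pow`).
[cite: AtiyahMacdonald1969, Ch. 8, Prop. 8.8 and Example] -/
theorem nonempty_algEquiv_quotient_span_pow {G : SchemeOver k} [IsFinite G.hom] {N : ℕ}
    (θ : (k[X] ⧸ Ideal.span {(X : k[X]) ^ N}) ≃ₐ[k] Alg G) {M : ℕ} (hM : M ≤ N) :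
    Nonempty ((Alg G ⧸ Ideal.span {θ (Ideal.Quotient.mk _ X) ^ M}) ≃ₐ[k] (k[X] ⧸ Ideal.span {(X : k[X]) ^ M})) := by
  set x : Alg G := θ (Ideal.Quotient.mk _ X) with hxdef
  set J : Ideal (Alg G) := Ideal.span {x ^ M} with hJ
  -- the map `X ↦ x̄`
  let φ₀ : k[X] →ₐ[k] Alg G ⧸ J := (Ideal.Quotient.mkₐ k J).comp (aeval x)
  have hφ₀ : ∀ a ∈ Ideal.span {(X : k[X]) ^ M}, φ₀ a = 0 := by
    intro a ha
    obtain ⟨r, rfl⟩ := Ideal.mem_span_singleton'.mp ha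
    change Ideal.Quotient.mk J (aeval x (r * X ^ M)) = 0
    rw [map_mul, map_pow, aeval_X, Ideal.Quotient.eq_zero_iff_mem]
    exact Ideal.mul_mem_left _ _ (Ideal.mem_span_singleton_self _)
  let φ : (k[X] ⧸ Ideal.span {(X : k[X]) ^ M}) →ₐ[k] Alg G ⧸ J := Ideal.Quotient.liftₐ _ φ₀ hφ₀
  -- onto: `A = k[x]`
  have hθmk : θ.toAlgHom.comp (Ideal.Quotient.mkₐ k _) = aeval x := by
    apply Polynomial.algHom_ext
    rw [AlgHom.comp_apply, Ideal.Quotient.mkₐ_eq_mk, aeval_X]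
    rfl
  have hsurj : Function.Surjective φ := by
    intro b
    obtain ⟨a, rfl⟩ := Ideal.Quotient.mk_surjective b
    obtain ⟨P, hP⟩ := Ideal.Quotient.mk_surjective (θ.symm a)
    refine ⟨Ideal.Quotient.mk _ P, ?_⟩
    have ha : a = aeval x P := by
      rw [← hθmk, AlgHom.comp_apply, Ideal.Quotient.mkₐ_eq_mk, hP]
      exact (θ.apply_symm_apply a).symm
    rw [ha]
    rfl
  -- same dimension
  haveI : Module.Finite k (Alg G) := Alg.moduleFinite G
  haveI : Module.Finite k (Alg G ⧸ J) := Module.Finite.of_surjective (Ideal.Quotient.mkₐ k J).toLinearMap Ideal.Quotient.mk_surjective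
  haveI : Module.Finite k (k[X] ⧸ Ideal.span {(X : k[X]) ^ M}) := (AdjoinRoot.powerBasis (pow_ne_zero M X_ne_zero)).finite
  have hdimA : Module.finrank k (Alg G ⧸ J) = M := by
    have h := finrank_quotient_span_symm_pow (G := G) θ.symm M
    rw [AlgEquiv.symm_symm] at h
    rw [h]
    exact min_eq_left hM
  have hdim : Module.finrank k (k[X] ⧸ Ideal.span {(X : k[X]) ^ M}) = Module.finrank k (Alg G ⧸ J) := by
    rw [hdimA, finrank_eq_of_algEquiv_quotient_X_pow (AlgEquiv.refl : (k[X] ⧸ Ideal.span {(X : k[X]) ^ M}) ≃ₐ[k] _)]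
  have hinj : Function.Injective φ :=
    (LinearMap.injective_iff_surjective_of_finrank_eq_finrank hdim (f := φ.toLinearMap)).mpr hsurj
  exact ⟨(AlgEquiv.ofBijective φ ⟨hinj, hsurj⟩).symm⟩

end Algebra

section Head

variable {k : Type u} [Field k]

/-- **`stub_N2_exponentOfKernel` — THE EXPONENT OF THE `ϖ`-KERNEL OF A CONNECTED ONE-DIMENSIONAL BARSOTTI–TATE `𝒪`-MODULE.**  For `C` connected
of dimension one (`IsConnectedDimOne C`, height `H₀ ≥ 1`) over a field `k` of characteristic `p` with a ring action `βC` of the DVR `𝒪` (finite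
residue field of cardinality `p^f`, uniformiser `ϖ`, `ϖ ∣ p ∣ ϖ^e`) and the `[ϖ]`-kernel socket `u : U ↪ C.G 1` (`hkerU`): **`Γ(U) ≃ₐ[k]
k[X]⧸(X^{p^{f h}})` for some `h ≥ 1`** (the `𝒪`-height).  Assembly of §1–§5: coordinates + law (★ (S) + ★ (P4b)), height dichotomy (★ Fröhlich),
kernel clause (★ HL-C), the layer-2 test (`[ϖ]_M ≠ 0`, `f h ≤ H₀`), the ideal `(x₁^{q^h})`, the algebra.  Binders: the stub's, in order, minus
the unused `[IsAlgClosed k]` `[ExpChar k p]`. [cite: HarrisTaylorAMS2001, §II.1 p. 59, §II.2] [cite: Tate1967, §2.2] [cite: Hazewinkel1978, (18.3.4), (21.8.12)] -/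
theorem exists_algEquiv_quotient_X_pow_of_uniformizerKernel (p f : ℕ) [Fact p.Prime] [CharP k p]
    (𝒪 : Type v) [CommRing 𝒪] [IsDomain 𝒪] [IsDiscreteValuationRing 𝒪] [Finite (IsLocalRing.ResidueField 𝒪)] (ϖ : 𝒪)
    {H₀ : ℕ} (C : BTGroup (Spec (.of k)) p H₀) (hC : IsConnectedDimOne C) (hH₀ : 0 < H₀)
    (hϖ : Irreducible ϖ) (hpe : ∃ e : ℕ, (p : 𝒪) ∣ ϖ ^ e) (hϖp : ϖ ∣ (p : 𝒪))
    (hq : Nat.card (IsLocalRing.ResidueField 𝒪) = p ^ f)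
    (βC : 𝒪 → BTGroup.Hom C C) (hβC : IsRingActionBT C βC)
    (U : SchemeOver k) [GrpObj U] (u : U ⟶ C.G 1) (hu : letI := C.grpObj 1; IsMonHom u ∧ IsClosedImmersion u.left)
    (hkerU : letI := C.grpObj 1; ∀ ⦃T : SchemeOver k⦄ (t : T ⟶ C.G 1), t ≫ (βC ϖ).app 1 = 1 ↔ ∃ s : T ⟶ U, s ≫ u = t) :
    ∃ h : ℕ, 0 < h ∧ Nonempty (Alg U ≃ₐ[k] (k[X] ⧸ Ideal.span {(X : k[X]) ^ (p ^ (f * h))})) := by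
  have hprime : p.Prime := Fact.out
  have hp2 : 2 ≤ p := hprime.two_le
  have hpk : (p : k) = 0 := CharP.cast_eq_zero k p
  haveI hAff : ∀ n, IsAffine (C.G n).left := C.isAffine_left
  letI := C.grpObj 1
  letI := C.grpObj 2
  obtain ⟨x, θ, c, χ, M, hθ, hc, hincl, hone, hact⟩ := exists_coordinates_law_of_isConnectedDimOne C hp2 hH₀ hC βC hβC
  letI := χ.toAlgebra
  have hχϖ : algebraMap 𝒪 k ϖ = 0 := map_uniformizer_eq_zero p hpk χ ϖ hpe
  -- the generator of layer 1 is nilpotent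
  have hx1 : IsNilpotent (x 1) := by
    refine ⟨p ^ (1 * H₀), ?_⟩
    rw [← hθ 1, ← map_pow, ← map_pow, Ideal.Quotient.eq_zero_iff_mem.mpr (Ideal.mem_span_singleton_self _), map_zero]
  -- dichotomy
  rcases act_eq_zero_or_exists_isOfHeight ϖ hϖ hχϖ M with h0 | ⟨h, hh, hMh⟩
  · -- `[ϖ]_M = 0`: every point is killed — impossible by the layer-2 test
    exfalso
    refine false_of_forall_pow_eq_zero_comp_app_eq_one C c hp2 hH₀ hβC hϖp hincl (N := p ^ (H₀ + 1)) le_rfl ?_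
    intro R _ _ t _
    apply (c 2 R).injective
    apply Subtype.ext
    rw [hact, h0, hone]
    exact Literature.RingTheory.FormalGroups.evalNilp_zero _
  · -- the kernel clause at `m = 1`: `[ϖ]_M y = 0 ↔ y^{p^{fh}} = 0`
    have hq0 : 0 < Nat.card (IsLocalRing.ResidueField 𝒪) := Nat.card_pos
    have hkill : ∀ (R : Type u) [CommRing R] [Algebra k R] (y : R), IsNilpotent y →
        (evalNilp (M.act ϖ).toPowerSeries y = 0 ↔ y ^ (p ^ (f * h)) = 0) := by
      intro R _ _ y hy
      have hK := FormalOModuleLaw.kernelPointsOfHeight 𝒪 k M ϖ _ h hq0 hMh 1 R y hy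
      rwa [pow_one, mul_one, hq, ← pow_mul] at hK
    -- `f h ≤ H₀` by the layer-2 test
    have hle : f * h ≤ H₀ := by
      by_contra hlt
      refine false_of_forall_pow_eq_zero_comp_app_eq_one C c hp2 hH₀ hβC hϖp hincl (N := p ^ (f * h))
        (Nat.pow_le_pow_right hprime.pos (by omega)) ?_
      intro R _ _ t ht
      apply (c 2 R).injective
      apply Subtype.ext
      rw [hact, hone]
      exact (hkill R _ ⟨_, ((c 2 R) t).2⟩).mpr ht
    -- the ideal and the algebra
    have hker := ker_appTop_eq_span_pow C x c hc hone hact hkill hx1 U u hu.2 hkerU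
    haveI : IsClosedImmersion u.left := hu.2
    haveI : IsAffine U.left := isAffine_left_of_isClosedImmersion u
    haveI : IsFinite (C.G 1).hom := C.isFinite 1
    obtain ⟨e₁, -⟩ := exists_algEquiv_quotient_ker_appTop u
    have hM : p ^ (f * h) ≤ p ^ (1 * H₀) := by
      rw [one_mul]; exact Nat.pow_le_pow_right hprime.pos hle
    obtain ⟨e₂⟩ := nonempty_algEquiv_quotient_span_pow (θ 1) hM
    rw [hθ 1] at e₂
    exact ⟨h, hh, ⟨e₁.symm.trans ((Ideal.quotientEquivAlgOfEq k hker).trans e₂)⟩⟩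

end Head

end Literature.AlgebraicGeometry.GroupSchemes.UniformizerKernel

end
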